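import Literature.MathematicalPhysics.QuantumFieldTheory.Balaban1983to89.T4InteractionCauchy

/-!
# T4PrecisionDecay — the (W1′a,b) localisation data of the NE1′ tower bound from COERCIVITY
AND PLAIN EXPONENTIAL DECAY OF THE GRAM PRECISION (the (5.6)-shape), with the Combes–Thomas
rate and every constant explicit; the quadratic residual; slice-holomorphy from holomorphy on
an open set; and the end-to-end corollary

HEADLINE.  `[folklore]` throughout, 0 citations.  This leaf continues `T4InteractionCauchy`
(its §6 theorem `integral_sq_sub_towerMean_le_of_graded_geometric_analyticInteraction_torus_pathLaw`,
"(ES-rep-W‴)" in the record `t4/T4-EST-NE1p-P2.md`).  Three groups of binders of that theorem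
are re-expressed in the currency in which such data is usually DISPLAYED:

* (W1′a,b) `hργ hκ hcoer hMrow hMcol` (and the rate in `hNK`) — there, the `(e^{κ d} − 1)`-weighted
  absolute row and column sums of the Gram precision `BᵀB` at some rate `κ > 0` are INPUT numbers
  `ρ < γ`.  Here they are DERIVED from: a coercivity constant `γ₀ > 0` of `BᵀB` and an entrywise bound
  `|(BᵀB) i j| ≤ c₀ e^{−δ₀ d(i,j)}` in the torus distance of the injected raw sites (the shape of
  condition (5.6) typed in `B4Sect5Torus.Hyp56`), BY NAME from the tree's torus reading of the
  Sect. 5 engine: the rate is the (5.7)-rate `δ₁ = B4Sect5Proof.delta1 d N₀ γ₀ c₀ δ₀`, the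
  weighted sums are `≤ δ₁ M₀` (`M₀ = B4Sect5Proof.weightConst d N₀ c₀ δ₀`,
  `B4Sect5Torus.weightedRowSum_le / weightedColSum_le` with the profile
  `T4InteractionTransport.sumBound_embDist`), `δ₁ M₀ ≤ γ₀/2`
  (`B4Sect5Proof.delta1_mul_weightConst_le`), hence `(γ₀ − δ₁M₀)⁻¹ ≤ 2/γ₀` and the transported
  constants are `s_r = (2/γ₀) N β_c`, `s_c = (2/γ₀) N β_r` for any `N ≥ N₀ K_d(δ₁)` — five numbers
  `γ₀, c₀, δ₀, N₀, d` and the locality sums `β_r, β_c` of `|B|`, all free of the step, the history,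
  the depth and the volume;
* the RESIDUAL piece `Pres` with its displayed discrete data `(H_R, Hs_R, G_R, g_R)` — here
  SPECIALISED to a quadratic remainder `½⟨u, Q_{b,h} u⟩` of the raw quadratic form (record
  (W0′): the Gaussian precision is a Gram operator up to a remainder), whose pair dominator is the
  tree's `T4InteractionTransport.pairDomOn_quadForm` and whose coordinate Lipschitz vector on a
  box with coordinates bounded by `U_b` is proved here (§1: `lipOn_quadForm`,
  `|∂_l ½⟨u,Qu⟩| ≤ ½ ∑_{l'} (|Q l l'| + |Q l' l|) · U_b`); the displayed numbers become the row and
  column sums `q_r b, q_c b` of `|Q_{b,h}|` and the box bound `U_b`;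
* the SLICE-HOLOMORPHY binder `hhol` (complex differentiability of each term in each support
  coordinate separately at every point of the closed polydisc thickening) — here derived (§3) from
  holomorphy (`DifferentiableOn ℂ`) of the term on an OPEN set of complex configurations containing
  the thickening, which is how analyticity of localised terms on a complex neighbourhood of the
  small-field box is usually stated.

EVERY OTHER BINDER of the parent — path law and kernels, the Gram representation `hrep`, the
convex raw boxes, radius, terms, supports, sup bounds `mX` and localisation counts `ms1, ms2`, the
locality sums `β_r, β_c` of `|B|`, raw ES sensitivities, domination, graded-geometric profile — is
passed VERBATIM; the smallness hypotheses are stated with the explicit constants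
`s_r = (2/γ₀) N β_c`, `s_c = (2/γ₀) N β_r`, `Hs_R b = ½ (q_r b + q_c b)`,
`g_R b = ½ (q_r b + q_c b) U_b`, and the conclusion is the parent's with `s_r s_c` so specialised.

ORIENTATION ONLY (neither used nor asserted by any declaration; the record carries the located
pointers and their status): in print a uniform lower bound of the fluctuation precision and the
exponential decay of the relevant kernels, with constants depending on the dimension and the
block size only, are the form in which such input appears; WHETHER the printed operators satisfy
the displayed hypotheses, and with which numbers, is NOT derived here and NOT cited — `γ₀, c₀,
δ₀`, the Gram identification `hrep`, the remainder `Q`, the sizes `mX, ms1, ms2, δr, U_b` stay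
displayed hypotheses of §5.

## Honest flags

* `[folklore]`: finite sums, `|·|`-bookkeeping of a quadratic form, the elementary inequality
  `(γ₀ − ρ)⁻¹ ≤ 2/γ₀` for `ρ ≤ γ₀/2`, the chain rule for `Function.update` from Mathlib by name,
  and by-name applications of `B4Sect5Torus.weightedRowSum_le / weightedColSum_le`,
  `T4InteractionTransport.sumBound_embDist / pairDomOn_quadForm` and of the parent theorem.
  0 citations; nothing printed is reproduced, quoted or claimed; no `def … : Prop` of this file
  asserts anything about print (this file has no definitions at all).
* BetaPertH / (B) / (B^μ) are untouched and appear nowhere.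
* Finite `T⁴` format throughout (finitely many raw and whitened sites and finitely many terms per
  step, finitely many steps); no infinite-volume or continuum statement is made or implied.
-/

noncomputable section

open MeasureTheory ProbabilityTheory Finset Function Matrix Metric
open scoped ENNReal

namespace Literature.MathematicalPhysics.QuantumFieldTheory.Balaban1983to89.T4PrecisionDecay

open Literature.MathematicalPhysics.QuantumFieldTheory.Balaban1983to89.T4CouplingChain
open Literature.MathematicalPhysics.QuantumFieldTheory.Balaban1983to89.T4CouplingIncoherence
open Literature.MathematicalPhysics.QuantumFieldTheory.Balaban1983to89.T4DobrushinTensorisation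
open Literature.MathematicalPhysics.QuantumFieldTheory.Balaban1983to89.T4GaussianWhitening
open Literature.MathematicalPhysics.QuantumFieldTheory.Balaban1983to89.T4WhiteningFactor
open Literature.MathematicalPhysics.QuantumFieldTheory.Balaban1983to89.T4InteractionTransport
open Literature.MathematicalPhysics.QuantumFieldTheory.Balaban1983to89.T4InteractionCauchy
open Literature.MathematicalPhysics.QuantumFieldTheory.Balaban1983to89.QGQInverse
open Literature.MathematicalPhysics.QuantumFieldTheory.Balaban1983to89.B4Sect5Torus

universe u v w

/-! ## §1 The coordinate Lipschitz vector of a quadratic form on a bounded box -/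

section QuadForm

variable {Λ : Type w} [Fintype Λ] [DecidableEq Λ]

omit [DecidableEq Λ] in
/-- `[folklore]` One row of `|Q u|` on a box with coordinates bounded by `U`. -/
theorem abs_mulVec_apply_le (Q : Matrix Λ Λ ℝ) {u : Λ → ℝ} {U : ℝ} (hu : ∀ k, |u k| ≤ U) (l : Λ) :
    |(Q *ᵥ u) l| ≤ (∑ l', |Q l l'|) * U := by
  have h0 : (Q *ᵥ u) l = ∑ l', Q l l' * u l' := rfl
  rw [h0, Finset.sum_mul]
  refine (Finset.abs_sum_le_sum_abs _ _).trans (Finset.sum_le_sum fun l' _ => ?_)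
  rw [abs_mul]
  exact mul_le_mul_of_nonneg_left (hu l') (abs_nonneg _)

omit [DecidableEq Λ] in
/-- `[folklore]` One column: `|∑_{l'} u l' Q l' l| ≤ (∑_{l'} |Q l' l|) · U`. -/
theorem abs_sum_mul_col_le (Q : Matrix Λ Λ ℝ) {u : Λ → ℝ} {U : ℝ} (hu : ∀ k, |u k| ≤ U) (l : Λ) :
    |∑ l', u l' * Q l' l| ≤ (∑ l', |Q l' l|) * U := by
  rw [Finset.sum_mul]
  refine (Finset.abs_sum_le_sum_abs _ _).trans (Finset.sum_le_sum fun l' _ => ?_)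
  rw [abs_mul, mul_comm]
  exact mul_le_mul_of_nonneg_left (hu l') (abs_nonneg _)

/-- `[folklore]` **The quadratic instance of `LipOn`**: on a coordinate box all of whose
coordinates are bounded by `U` in absolute value, `u ↦ ½⟨u, Q u⟩` has the coordinate Lipschitz
vector `l ↦ ½ (∑_{l'} (|Q l l'| + |Q l' l|)) · U` (exact first differences of a quadratic form:
`½⟨u',Qu'⟩ − ½⟨u,Qu⟩ = ½ a (Qu')_l + ½ a (Qᵀu)_l` for `u' = u + a·1_l`).  Companion of
`T4InteractionTransport.pairDomOn_quadForm`. -/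
theorem lipOn_quadForm (D : Λ → Set ℝ) (Q : Matrix Λ Λ ℝ) {U : ℝ}
    (hU : ∀ l, ∀ t ∈ D l, |t| ≤ U) :
    LipOn D (fun u => (1 / 2 : ℝ) * (u ⬝ᵥ (Q *ᵥ u)))
      (fun l => (1 / 2 : ℝ) * (∑ l', (|Q l l'| + |Q l' l|)) * U) := by
  intro ξ hξ l t ht
  dsimp only
  set a : ℝ := t - ξ l with ha
  have hupd : update ξ l t = ξ + Pi.single l a := by
    funext k
    by_cases hk : k = l
    · subst hk; simp [ha]
    · simp [hk]
  have hξU : ∀ k, |ξ k| ≤ U := fun k => hU k (ξ k) (hξ k)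
  have hξ'U : ∀ k, |update ξ l t k| ≤ U := by
    intro k
    by_cases hk : k = l
    · subst hk; simpa using hU k t ht
    · rw [update_of_ne hk]; exact hξU k
  have h1 : Pi.single l a ⬝ᵥ (Q *ᵥ update ξ l t) = a * (Q *ᵥ update ξ l t) l :=
    single_dotProduct _ _ _
  have h2 : ξ ⬝ᵥ (Q *ᵥ Pi.single l a) = (∑ l', ξ l' * Q l' l) * a := by
    rw [Matrix.dotProduct_mulVec, dotProduct_single]; rfl
  have hid : update ξ l t ⬝ᵥ (Q *ᵥ update ξ l t) - ξ ⬝ᵥ (Q *ᵥ ξ) =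
      a * (Q *ᵥ update ξ l t) l + (∑ l', ξ l' * Q l' l) * a := by
    have e1 : update ξ l t ⬝ᵥ (Q *ᵥ update ξ l t) - ξ ⬝ᵥ (Q *ᵥ ξ) =
        (update ξ l t - ξ) ⬝ᵥ (Q *ᵥ update ξ l t) + ξ ⬝ᵥ (Q *ᵥ (update ξ l t - ξ)) := by
      simp only [sub_dotProduct, Matrix.mulVec_sub, dotProduct_sub]; ring
    have e2 : update ξ l t - ξ = Pi.single l a := by rw [hupd]; abel
    rw [e1, e2, h1, h2]
  have hb1 : |a * (Q *ᵥ update ξ l t) l| ≤ |a| * ((∑ l', |Q l l'|) * U) := by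
    rw [abs_mul]
    exact mul_le_mul_of_nonneg_left (abs_mulVec_apply_le Q hξ'U l) (abs_nonneg a)
  have hb2 : |(∑ l', ξ l' * Q l' l) * a| ≤ ((∑ l', |Q l' l|) * U) * |a| := by
    rw [abs_mul]
    exact mul_le_mul_of_nonneg_right (abs_sum_mul_col_le Q hξU l) (abs_nonneg a)
  calc |1 / 2 * (update ξ l t ⬝ᵥ (Q *ᵥ update ξ l t)) - 1 / 2 * (ξ ⬝ᵥ (Q *ᵥ ξ))|
      = 1 / 2 * |a * (Q *ᵥ update ξ l t) l + (∑ l', ξ l' * Q l' l) * a| := by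
        rw [← mul_sub, hid, abs_mul, abs_of_pos (by norm_num : (0 : ℝ) < 1 / 2)]
    _ ≤ 1 / 2 * (|a| * ((∑ l', |Q l l'|) * U) + ((∑ l', |Q l' l|) * U) * |a|) :=
        mul_le_mul_of_nonneg_left ((abs_add_le _ _).trans (add_le_add hb1 hb2)) (by norm_num)
    _ = 1 / 2 * (∑ l', (|Q l l'| + |Q l' l|)) * U * |t - ξ l| := by
        rw [Finset.sum_add_distrib, ← ha]; ring

omit [DecidableEq Λ] in
/-- `[folklore]` The column sums of the quadratic pair dominator `½ (|Q l l'| + |Q l' l|)` are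
half the column-plus-row sums of `|Q|`. -/
theorem sum_quadPairDom_le (Q : Matrix Λ Λ ℝ) {qr qc : ℝ} (hqr : ∀ l, ∑ l', |Q l l'| ≤ qr)
    (hqc : ∀ l', ∑ l, |Q l l'| ≤ qc) (l' : Λ) :
    ∑ l, (1 / 2 : ℝ) * (|Q l l'| + |Q l' l|) ≤ (1 / 2 : ℝ) * (qr + qc) := by
  rw [← Finset.mul_sum, Finset.sum_add_distrib]
  refine mul_le_mul_of_nonneg_left ?_ (by norm_num)
  rw [add_comm qr]
  exact add_le_add (hqc l') (hqr l')

omit [DecidableEq Λ] in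
/-- `[folklore]` The quadratic Lipschitz vector is at most `½ (q_r + q_c) U`. -/
theorem quadLip_le (Q : Matrix Λ Λ ℝ) {qr qc U : ℝ} (hU : 0 ≤ U) (hqr : ∀ l, ∑ l', |Q l l'| ≤ qr)
    (hqc : ∀ l', ∑ l, |Q l l'| ≤ qc) (l : Λ) :
    (1 / 2 : ℝ) * (∑ l', (|Q l l'| + |Q l' l|)) * U ≤ (1 / 2 : ℝ) * (qr + qc) * U := by
  refine mul_le_mul_of_nonneg_right (mul_le_mul_of_nonneg_left ?_ (by norm_num)) hU
  rw [Finset.sum_add_distrib]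
  exact add_le_add (hqr l) (hqc l)

end QuadForm

/-! ## §2 (W1′a,b) from coercivity and plain exponential decay of the Gram precision -/

section PrecisionDecay

variable {d : ℕ} {P : Fin d → ℕ} {Ω : Finset (TSite d P)} {N₀ : ℕ} {Λ : Type w} [Fintype Λ]

/-- `[folklore]` **Weighted ROW sums at the (5.7)-rate.**  If `|M i j| ≤ c₀ e^{−δ₀ d(i,j)}` in
the torus distance `d = embDist emb` of injected raw sites (`c₀ ≥ 0`, `δ₀ > 0`, `γ₀ > 0`), then
at the rate `δ₁ = B4Sect5Proof.delta1 d N₀ γ₀ c₀ δ₀` the `(e^{δ₁ d} − 1)`-weighted absolute row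
sums of `M` are `≤ δ₁ · M₀`, `M₀ = B4Sect5Proof.weightConst d N₀ c₀ δ₀` — BY NAME
`B4Sect5Torus.weightedRowSum_le` with the profile `T4InteractionTransport.sumBound_embDist`. -/
theorem weightedRowSum_embDist_le (hP : ∀ i, 1 ≤ P i) {emb : Λ → TIdx P Ω N₀}
    (hemb : Injective emb) (M : Matrix Λ Λ ℝ) {γ₀ c₀ δ₀ : ℝ} (hγ : 0 < γ₀) (hc : 0 ≤ c₀)
    (hδ : 0 < δ₀) (hM : ∀ i j, |M i j| ≤ c₀ * Real.exp (-(δ₀ * embDist emb i j))) (i : Λ) :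
    ∑ j, |M i j| * (Real.exp (B4Sect5Proof.delta1 d N₀ γ₀ c₀ δ₀ * embDist emb i j) - 1) ≤
      B4Sect5Proof.delta1 d N₀ γ₀ c₀ δ₀ * B4Sect5Proof.weightConst d N₀ c₀ δ₀ :=
  B4Sect5Torus.weightedRowSum_le (isPseudoDist_embDist hP emb).nonneg (sumBound_embDist hP hemb)
    M hc hδ (B4Sect5Proof.delta1_pos d N₀ hγ hc hδ).le
    (B4Sect5Proof.delta1_le_quarter d N₀ γ₀ c₀) hM i

/-- `[folklore]` **Weighted COLUMN sums at the (5.7)-rate** (`B4Sect5Torus.weightedColSum_le`). -/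
theorem weightedColSum_embDist_le (hP : ∀ i, 1 ≤ P i) {emb : Λ → TIdx P Ω N₀}
    (hemb : Injective emb) (M : Matrix Λ Λ ℝ) {γ₀ c₀ δ₀ : ℝ} (hγ : 0 < γ₀) (hc : 0 ≤ c₀)
    (hδ : 0 < δ₀) (hM : ∀ i j, |M i j| ≤ c₀ * Real.exp (-(δ₀ * embDist emb i j))) (j : Λ) :
    ∑ i, |M i j| * (Real.exp (B4Sect5Proof.delta1 d N₀ γ₀ c₀ δ₀ * embDist emb i j) - 1) ≤
      B4Sect5Proof.delta1 d N₀ γ₀ c₀ δ₀ * B4Sect5Proof.weightConst d N₀ c₀ δ₀ :=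
  B4Sect5Torus.weightedColSum_le (isPseudoDist_embDist hP emb) (sumBound_embDist hP hemb)
    M hc hδ (B4Sect5Proof.delta1_pos d N₀ hγ hc hδ).le
    (B4Sect5Proof.delta1_le_quarter d N₀ γ₀ c₀) hM j

omit [Fintype Λ] in
/-- `[folklore]` `δ₁ M₀ < γ₀` (from `δ₁ M₀ ≤ γ₀/2`, `B4Sect5Proof.delta1_mul_weightConst_le`). -/
theorem delta1_mul_weightConst_lt (d N₀ : ℕ) {γ₀ c₀ δ₀ : ℝ} (hγ : 0 < γ₀) (hc : 0 ≤ c₀)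
    (hδ : 0 < δ₀) :
    B4Sect5Proof.delta1 d N₀ γ₀ c₀ δ₀ * B4Sect5Proof.weightConst d N₀ c₀ δ₀ < γ₀ :=
  (B4Sect5Proof.delta1_mul_weightConst_le d N₀ hγ hc hδ).trans_lt (half_lt_self hγ)

omit [Fintype Λ] in
/-- `[folklore]` The Combes–Thomas constant at the (5.7)-rate is at most `2/γ₀`:
`(γ₀ − δ₁M₀)⁻¹ ≤ 2/γ₀`. -/
theorem inv_sub_delta1_mul_weightConst_le (d N₀ : ℕ) {γ₀ c₀ δ₀ : ℝ} (hγ : 0 < γ₀) (hc : 0 ≤ c₀)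
    (hδ : 0 < δ₀) :
    (γ₀ - B4Sect5Proof.delta1 d N₀ γ₀ c₀ δ₀ * B4Sect5Proof.weightConst d N₀ c₀ δ₀)⁻¹ ≤ 2 / γ₀ := by
  have h := B4Sect5Proof.delta1_mul_weightConst_le d N₀ hγ hc hδ
  calc (γ₀ - B4Sect5Proof.delta1 d N₀ γ₀ c₀ δ₀ * B4Sect5Proof.weightConst d N₀ c₀ δ₀)⁻¹
      ≤ (γ₀ / 2)⁻¹ := inv_anti₀ (half_pos hγ) (by linarith)
    _ = 2 / γ₀ := by rw [inv_div]

omit [Fintype Λ] in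
/-- `[folklore]` The profile at the (5.7)-rate is nonnegative, so any `N` above it is. -/
theorem profile_delta1_nonneg (d N₀ : ℕ) {γ₀ c₀ δ₀ : ℝ} (hγ : 0 < γ₀) (hc : 0 ≤ c₀)
    (hδ : 0 < δ₀) :
    0 ≤ (N₀ : ℝ) * B4Sect5Proof.latticeConst d (B4Sect5Proof.delta1 d N₀ γ₀ c₀ δ₀) :=
  profile_nonneg d N₀ _ (B4Sect5Proof.delta1_pos d N₀ hγ hc hδ)

end PrecisionDecay

/-! ## §3 Slice-holomorphy on the thickened box from holomorphy on an open set -/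

section SliceHol

variable {Λ : Type w} [Fintype Λ] [DecidableEq Λ]

/-- `[folklore]` A function complex-differentiable on an open set of complex configurations is
complex-differentiable in each coordinate separately at each of its points (chain rule with
`Function.update`, `hasFDerivAt_update` BY NAME). -/
theorem differentiableAt_update_of_differentiableOn {Fc : (Λ → ℂ) → ℂ} {Uc : Set (Λ → ℂ)}
    (hUo : IsOpen Uc) (hF : DifferentiableOn ℂ Fc Uc) {ζ : Λ → ℂ} (hζ : ζ ∈ Uc) (l : Λ) :
    DifferentiableAt ℂ (fun w => Fc (update ζ l w)) (ζ l) := by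
  have hFζ : DifferentiableAt ℂ Fc (update ζ l (ζ l)) := by
    rw [update_eq_self]
    exact hF.differentiableAt (hUo.mem_nhds hζ)
  exact DifferentiableAt.comp (ζ l) hFζ (hasFDerivAt_update ζ (ζ l)).differentiableAt

/-- `[folklore]` **The slice-holomorphy binder `hhol` of the parent from holomorphy on an open
set containing the closed polydisc thickening of the box.** -/
theorem sliceHol_cthick_of_differentiableOn {D : Λ → Set ℝ} {δ : Λ → ℝ} {Fc : (Λ → ℂ) → ℂ}
    {Uc : Set (Λ → ℂ)} (hUo : IsOpen Uc) (hsub : cthick D δ ⊆ Uc)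
    (hF : DifferentiableOn ℂ Fc Uc) (X : Finset Λ) :
    ∀ ζ ∈ cthick D δ, ∀ l ∈ X, DifferentiableAt ℂ (fun w => Fc (update ζ l w)) (ζ l) :=
  fun _ hζ l _ => differentiableAt_update_of_differentiableOn hUo hF (hsub hζ) l

end SliceHol

/-! ## §4 The NE1′ tower bound with (W1′a,b) from coercivity + decay of the Gram precision, a
quadratic residual, and holomorphy of the localised terms on open sets -/

section EndToEnd

open Preorder MeasureTheory.Filtration

variable {X : ℕ → Type*} [∀ n, MeasurableSpace (X n)]

open scoped Classical in
/-- `[folklore]` **NE1′ TOWER BOUND, GRAM-WHITENED GIBBS FORM, (W1′a,b) FROM COERCIVITY AND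
EXPONENTIAL DECAY OF THE GRAM PRECISION, QUADRATIC RESIDUAL, TERMS HOLOMORPHIC ON OPEN SETS.**
This is
`T4InteractionCauchy.integral_sq_sub_towerMean_le_of_graded_geometric_analyticInteraction_torus_pathLaw`
with

* (W1′a,b) `hργ hκ hcoer hMrow hMcol hNK` REPLACED by: `γ₀ > 0`, `c₀ ≥ 0`, `δ₀ > 0`, coercivity
  `Coercive ((Bm b h)ᵀ Bm b h) γ₀` and the entrywise decay
  `|((Bm b h)ᵀ Bm b h) i j| ≤ c₀ e^{−δ₀ d_b(i,j)}` in the torus distance `d_b = embDist (emb b)` of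
  the injected raw sites, for the performed steps `b < n` and all histories, and any
  `N ≥ N₀ · K_d(δ₁)` at the (5.7)-rate `δ₁ = B4Sect5Proof.delta1 d N₀ γ₀ c₀ δ₀`; the transported
  constants become `s_r = (2/γ₀) N β_c`, `s_c = (2/γ₀) N β_r` (§2);
* the residual piece SPECIALISED to the quadratic remainder `½⟨ξ, Q_{b,h} ξ⟩` of a displayed family
  of matrices `Qr b h` with absolute row sums `≤ q_r b` and column sums `≤ q_c b`, on raw boxes
  whose coordinates are bounded by `U_b ≥ 0` in absolute value; its data are
  `H_R = ½ (|Q l l'| + |Q l' l|)` (`pairDomOn_quadForm`), `Hs_R b = ½ (q_r b + q_c b)`,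
  `G_R = ½ ∑_{l'} (|Q l l'| + |Q l' l|) · U_b` (`lipOn_quadForm`), `g_R b = ½ (q_r b + q_c b) U_b`;
* the slice-holomorphy `hhol` REPLACED by open sets `Uc b h t ⊇ cthick (D b h) (δr b)` of complex
  configurations on which the terms `Fc b h t` are complex differentiable (§3);
* the readings bound `p b ≥ 0` made explicit (it is used to compare smallness constants).

The smallness hypotheses read `4 p_b² · s_r s_c · (4 ms2 b / δr b² + ½ (q_r b + q_c b)) ≤ α₀ < 1`
and `2 p_b · (ms1 b / δr b + ½ (q_r b + q_c b) U_b) · s_c ≤ ω`; every other binder is VERBATIM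
and the conclusion is the parent's with `s_r s_c = ((2/γ₀) N β_c) · ((2/γ₀) N β_r)`. -/
theorem integral_sq_sub_towerMean_le_of_graded_geometric_analyticInteraction_precisionDecay_torus_pathLaw
    (μ : Measure (Π n, X n)) [IsFiniteMeasure μ]
    (κ' : (b : ℕ) → Kernel (Π i : Iic b, X i) (X (b + 1))) [∀ b, IsMarkovKernel (κ' b)]
    (hκ' : ∀ b, μ.map (frestrictLe b) ⊗ₘ κ' b = μ.map (fun x => (frestrictLe b x, x (b + 1))))
    (n : ℕ) {φ : (Π k, X k) → ℝ} (hφn : StronglyMeasurable[piLE (X := X) n] φ) {R : ℝ}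
    (hφR : ∀ x, |φ x| ≤ R)
    {Λ : ℕ → Type w} [∀ b, Fintype (Λ b)] [∀ b, DecidableEq (Λ b)]
    {ι : ℕ → Type u} [∀ b, Fintype (ι b)] [∀ b, DecidableEq (ι b)] {E : (b : ℕ) → ι b → Type v}
    [∀ b i, MeasurableSpace (E b i)]
    {T : (b : ℕ) → (Π i : Iic b, X i) → (Λ b → ℝ) → X (b + 1)} (hT : ∀ b h, Measurable (T b h))
    (m : (b : ℕ) → (Π i : Iic b, X i) → Λ b → ℝ)
    (Bm : (b : ℕ) → (Π i : Iic b, X i) → Matrix (ι b) (Λ b) ℝ)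
    {e : (b : ℕ) → (i : ι b) → E b i → ℝ} (he : ∀ b i, Measurable (e b i))
    {p : ℕ → ℝ} (hp0 : ∀ b, 0 ≤ p b) (hep : ∀ b i x, |e b i x| ≤ p b)
    (π : (b : ℕ) → (Π i : Iic b, X i) → (i : ι b) → Measure (E b i))
    [∀ b h i, IsProbabilityMeasure (π b h i)] {v : ℝ} (hv0 : 0 ≤ v)
    (hv : ∀ b h i, ∫ y, e b i y ^ 2 ∂(π b h i) ≤ v)
    -- the RAW interaction on a raw box containing the image of the whitened configurations
    {D : (b : ℕ) → (Π i : Iic b, X i) → Λ b → Set ℝ}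
    (hD : ∀ b < n, ∀ h η l, affine (m b h) (whiteningFactor (Bm b h)) (e b) η l ∈ D b h l)
    (Praw : (b : ℕ) → (Π i : Iic b, X i) → (Λ b → ℝ) → ℝ)
    (hPm : ∀ b < n, ∀ h, Measurable (Praw b h))
    {a : (b : ℕ) → (Π i : Iic b, X i) → ℝ}
    (hPb : ∀ b < n, ∀ h ξ, (∀ l, ξ l ∈ D b h l) → |Praw b h ξ| ≤ a b h)
    (hrep : ∀ b < n, ∀ h, κ' b h =
      (gibbsMeasure (π b h)
          (fun η => Praw b h (affine (m b h) (whiteningFactor (Bm b h)) (e b) η))).map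
        (fun η => T b h (affine (m b h) (whiteningFactor (Bm b h)) (e b) η)))
    -- convex boxes with bounded coordinates, a radius, localised terms holomorphic on open sets
    -- containing the thickened box with sup bounds there, the quadratic residual, the expansion
    -- on the real box, the localisation counts
    (hDc : ∀ b < n, ∀ h l, Convex ℝ (D b h l))
    {Ub : ℕ → ℝ} (hUb0 : ∀ b, 0 ≤ Ub b) (hUb : ∀ b < n, ∀ h l, ∀ t ∈ D b h l, |t| ≤ Ub b)
    {δr : ℕ → ℝ} (hδr : ∀ b, 0 < δr b)
    {Tm : ℕ → Type*} [∀ b, Fintype (Tm b)]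
    (supp : (b : ℕ) → (Π i : Iic b, X i) → Tm b → Finset (Λ b))
    (Fc : (b : ℕ) → (Π i : Iic b, X i) → Tm b → (Λ b → ℂ) → ℂ)
    (hdep : ∀ b < n, ∀ h t, DepOn (supp b h t) (Fc b h t))
    (Uc : (b : ℕ) → (Π i : Iic b, X i) → Tm b → Set (Λ b → ℂ))
    (hUo : ∀ b < n, ∀ h t, IsOpen (Uc b h t))
    (hUsub : ∀ b < n, ∀ h t, cthick (D b h) (fun _ => δr b) ⊆ Uc b h t)
    (hFhol : ∀ b < n, ∀ h t, DifferentiableOn ℂ (Fc b h t) (Uc b h t))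
    {mX : (b : ℕ) → (Π i : Iic b, X i) → Tm b → ℝ} (hmX0 : ∀ b < n, ∀ h t, 0 ≤ mX b h t)
    (hmX : ∀ b < n, ∀ h t, ∀ ζ ∈ cthick (D b h) (fun _ => δr b), ‖Fc b h t ζ‖ ≤ mX b h t)
    (Qr : (b : ℕ) → (Π i : Iic b, X i) → Matrix (Λ b) (Λ b) ℝ)
    {qr qc : ℕ → ℝ} (hqr0 : ∀ b, 0 ≤ qr b) (hqc0 : ∀ b, 0 ≤ qc b)
    (hqr : ∀ b < n, ∀ h l, ∑ l', |Qr b h l l'| ≤ qr b)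
    (hqc : ∀ b < n, ∀ h l', ∑ l, |Qr b h l l'| ≤ qc b)
    (hexp : ∀ b < n, ∀ h ξ, (∀ l, ξ l ∈ D b h l) →
      Praw b h ξ = ∑ t, (Fc b h t (toC ξ)).re + (1 / 2 : ℝ) * (ξ ⬝ᵥ (Qr b h *ᵥ ξ)))
    {ms1 ms2 : ℕ → ℝ} (hms1 : ∀ b, 0 ≤ ms1 b) (hms2 : ∀ b, 0 ≤ ms2 b)
    (hm1 : ∀ b < n, ∀ h l, ∑ t, (if l ∈ supp b h t then mX b h t else 0) ≤ ms1 b)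
    (hm2 : ∀ b < n, ∀ h l',
      ∑ t, (if l' ∈ supp b h t then ((supp b h t).card : ℝ) * mX b h t else 0) ≤ ms2 b)
    -- raw ES sensitivities, verbatim
    {c : (b : ℕ) → (Π i : Iic b, X i) → Λ b → ℝ}
    (hc : ∀ b < n, ∀ h, LipOn (D b h) (fun ξ => fiberMean κ' (b + 1) φ (succGlue b (h, T b h ξ)))
      (c b h))
    -- (W1′) on the torus: site data; COERCIVITY AND ENTRYWISE DECAY of the Gram precision; locality
    {d : ℕ} {Pv : ℕ → Fin d → ℕ} (hPv : ∀ b i, 1 ≤ Pv b i)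
    (Ω : (b : ℕ) → Finset (TSite d (Pv b))) (N₀ : ℕ)
    (emb : (b : ℕ) → Λ b → TIdx (Pv b) (Ω b) N₀) (hemb : ∀ b, Injective (emb b))
    {γ₀ c₀ δ₀ : ℝ} (hγ₀ : 0 < γ₀) (hc₀ : 0 ≤ c₀) (hδ₀ : 0 < δ₀)
    (hcoer : ∀ b < n, ∀ h, Coercive ((Bm b h)ᵀ * Bm b h) γ₀)
    (hdec : ∀ b < n, ∀ h (i j : Λ b),
      |((Bm b h)ᵀ * Bm b h) i j| ≤ c₀ * Real.exp (-(δ₀ * embDist (emb b) i j)))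
    {N : ℝ} (hNK : (N₀ : ℝ) * B4Sect5Proof.latticeConst d (B4Sect5Proof.delta1 d N₀ γ₀ c₀ δ₀) ≤ N)
    {βr βc : ℝ} (hβr : 0 ≤ βr) (hBr : ∀ b < n, ∀ h (i : ι b), ∑ l, |Bm b h i l| ≤ βr)
    (hβc : 0 ≤ βc) (hBc : ∀ b < n, ∀ h (l : Λ b), ∑ i, |Bm b h i l| ≤ βc)
    -- smallness of the transported constants, with s_r = (2/γ₀) N β_c, s_c = (2/γ₀) N β_r
    {α₀ : ℝ} (hα₀ : α₀ < 1)
    (hα : ∀ b, 4 * p b ^ 2 * ((2 / γ₀ * N * βc) * (2 / γ₀ * N * βr) *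
      (4 * ms2 b / δr b ^ 2 + (1 / 2 : ℝ) * (qr b + qc b))) ≤ α₀)
    {ω : ℝ} (hω0 : 0 ≤ ω)
    (hωb : ∀ b, 2 * p b *
      ((ms1 b / δr b + (1 / 2 : ℝ) * (qr b + qc b) * Ub b) * (2 / γ₀ * N * βr)) ≤ ω)
    -- measurability / boundedness side conditions and the graded-geometric profile, verbatim
    (hWm : ∀ b, StronglyMeasurable (fun h => ∑ l, c b h l ^ 2)) {CW : ℝ}
    (hWb : ∀ b h, |∑ l, c b h l ^ 2| ≤ CW)
    (Mf : (b : ℕ) → Finset (Λ b)) {C κ₁ Etot : ℝ} (hκ₁ : 1 ≤ κ₁) {Θ : ℕ → ℝ}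
    {J : ℕ → Type*} (Jset : (b : ℕ) → Λ b → Finset (J b))
    {Aev : (b : ℕ) → Λ b → J b → Set (Π i : Iic b, X i)}
    (hA : ∀ b < n, ∀ l ∈ Mf b, ∀ j ∈ Jset b l, MeasurableSet (Aev b l j))
    (hc0 : ∀ b < n, ∀ h, ∀ l ∉ Mf b, c b h l = 0)
    (hcg : ∀ b < n, ∀ h, ∀ l ∈ Mf b,
      |c b h l| ≤ C * Θ b * κ₁ ^ ((Jset b l).filter fun j => h ∈ Aev b l j).card)
    {ε : (b : ℕ) → Λ b → J b → ℝ} (hε : ∀ b < n, ∀ l ∈ Mf b, ∀ j ∈ Jset b l, 0 ≤ ε b l j)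
    (hE : ∀ b < n, ∀ l ∈ Mf b, ∑ j ∈ Jset b l, ε b l j ≤ Etot)
    (hdomA : ∀ b < n, ∀ l ∈ Mf b, ∀ S' ⊆ Jset b l,
      μ.real (⋂ j ∈ S', {x | frestrictLe b x ∈ Aev b l j}) ≤ μ.real Set.univ * ∏ j ∈ S', ε b l j)
    {P r : ℝ} (hP : 0 ≤ P) (hr0 : 0 ≤ r) (hr1 : r < 1)
    (hgeo : ∀ b, ((Mf b).card : ℝ) * (Θ b ^ 2 * (Real.exp ω * (2 * v + 2 * p b ^ 2))) ≤ P * r ^ b) :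
    ∫ x, (φ x - towerMean κ' φ (x 0)) ^ 2 ∂μ ≤
      (1 / (1 - α₀)) * ((1 / 2 : ℝ) * (C ^ 2 * ((2 / γ₀ * N * βc) * (2 / γ₀ * N * βr))) *
        (μ.real Set.univ * Real.exp ((κ₁ ^ 2 - 1) * Etot)) * (P / (1 - r))) := by
  -- the Combes–Thomas rate and weighted-sum bound from (γ₀, c₀, δ₀) and the profile
  set κ : ℝ := B4Sect5Proof.delta1 d N₀ γ₀ c₀ δ₀ with hκdef
  set ρ : ℝ := κ * B4Sect5Proof.weightConst d N₀ c₀ δ₀ with hρdef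
  have hκ : 0 < κ := B4Sect5Proof.delta1_pos d N₀ hγ₀ hc₀ hδ₀
  have hργ : ρ < γ₀ := delta1_mul_weightConst_lt d N₀ hγ₀ hc₀ hδ₀
  have hinv : (γ₀ - ρ)⁻¹ ≤ 2 / γ₀ :=
    inv_sub_delta1_mul_weightConst_le d N₀ hγ₀ hc₀ hδ₀
  have hinv0 : 0 ≤ (γ₀ - ρ)⁻¹ := inv_nonneg.mpr (by linarith)
  have hN0 : 0 ≤ N := (profile_delta1_nonneg d N₀ hγ₀ hc₀ hδ₀).trans hNK
  have hMrow : ∀ b < n, ∀ h (i : Λ b),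
      ∑ j, |((Bm b h)ᵀ * Bm b h) i j| * (Real.exp (κ * embDist (emb b) i j) - 1) ≤ ρ :=
    fun b hb h i => weightedRowSum_embDist_le (hPv b) (hemb b) _ hγ₀ hc₀ hδ₀ (hdec b hb h) i
  have hMcol : ∀ b < n, ∀ h (j : Λ b),
      ∑ i, |((Bm b h)ᵀ * Bm b h) i j| * (Real.exp (κ * embDist (emb b) i j) - 1) ≤ ρ :=
    fun b hb h j => weightedColSum_embDist_le (hPv b) (hemb b) _ hγ₀ hc₀ hδ₀ (hdec b hb h) j
  -- the transported constants at the rate κ are dominated by the displayed ones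
  have hsr : (γ₀ - ρ)⁻¹ * N * βc ≤ 2 / γ₀ * N * βc :=
    mul_le_mul_of_nonneg_right (mul_le_mul_of_nonneg_right hinv hN0) hβc
  have hsc : (γ₀ - ρ)⁻¹ * N * βr ≤ 2 / γ₀ * N * βr :=
    mul_le_mul_of_nonneg_right (mul_le_mul_of_nonneg_right hinv hN0) hβr
  have hsr0 : 0 ≤ (γ₀ - ρ)⁻¹ * N * βc := mul_nonneg (mul_nonneg hinv0 hN0) hβc
  have hsc0 : 0 ≤ (γ₀ - ρ)⁻¹ * N * βr := mul_nonneg (mul_nonneg hinv0 hN0) hβr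
  have hss : (γ₀ - ρ)⁻¹ * N * βc * ((γ₀ - ρ)⁻¹ * N * βr) ≤
      2 / γ₀ * N * βc * (2 / γ₀ * N * βr) := mul_le_mul hsr hsc hsc0 (hsr0.trans hsr)
  -- the quadratic residual data
  have hHs0 : ∀ b, 0 ≤ 4 * ms2 b / δr b ^ 2 + (1 / 2 : ℝ) * (qr b + qc b) := fun b =>
    add_nonneg (div_nonneg (mul_nonneg (by norm_num) (hms2 b)) (pow_nonneg (hδr b).le 2))
      (mul_nonneg (by norm_num) (add_nonneg (hqr0 b) (hqc0 b)))
  have hg0 : ∀ b, 0 ≤ ms1 b / δr b + (1 / 2 : ℝ) * (qr b + qc b) * Ub b := fun b =>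
    add_nonneg (div_nonneg (hms1 b) (hδr b).le)
      (mul_nonneg (mul_nonneg (by norm_num) (add_nonneg (hqr0 b) (hqc0 b))) (hUb0 b))
  have hα' : ∀ b, 4 * p b ^ 2 * (((γ₀ - ρ)⁻¹ * N * βc) * ((γ₀ - ρ)⁻¹ * N * βr) *
      (4 * ms2 b / δr b ^ 2 + (1 / 2 : ℝ) * (qr b + qc b))) ≤ α₀ := fun b =>
    (mul_le_mul_of_nonneg_left (mul_le_mul_of_nonneg_right hss (hHs0 b))
      (mul_nonneg (by norm_num) (sq_nonneg (p b)))).trans (hα b)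
  have hωb' : ∀ b, 2 * p b *
      ((ms1 b / δr b + (1 / 2 : ℝ) * (qr b + qc b) * Ub b) * ((γ₀ - ρ)⁻¹ * N * βr)) ≤ ω :=
    fun b => (mul_le_mul_of_nonneg_left (mul_le_mul_of_nonneg_left hsc (hg0 b))
      (mul_nonneg (by norm_num) (hp0 b))).trans (hωb b)
  -- the parent, with the slice-holomorphy from §3 and the quadratic residual from §1
  have main :=
    integral_sq_sub_towerMean_le_of_graded_geometric_analyticInteraction_torus_pathLaw μ κ' hκ' n
      hφn hφR hT m Bm he hep π hv0 hv hD Praw hPm hPb hrep hDc hδr supp Fc hdep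
      (fun b hb h t => sliceHol_cthick_of_differentiableOn (hUo b hb h t) (hUsub b hb h t)
        (hFhol b hb h t) (supp b h t))
      hmX0 hmX (fun b h ξ => (1 / 2 : ℝ) * (ξ ⬝ᵥ (Qr b h *ᵥ ξ)))
      (fun b h l l' => (1 / 2 : ℝ) * (|Qr b h l l'| + |Qr b h l' l|))
      (fun b _ h l l' => mul_nonneg (by norm_num) (add_nonneg (abs_nonneg _) (abs_nonneg _)))
      (fun b _ h => pairDomOn_quadForm (D b h) (Qr b h))
      (HsR := fun b => (1 / 2 : ℝ) * (qr b + qc b))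
      (fun b => mul_nonneg (by norm_num) (add_nonneg (hqr0 b) (hqc0 b)))
      (fun b hb h l' => sum_quadPairDom_le (Qr b h) (hqr b hb h) (hqc b hb h) l')
      (GR := fun b h l => (1 / 2 : ℝ) * (∑ l', (|Qr b h l l'| + |Qr b h l' l|)) * Ub b)
      (fun b hb h => lipOn_quadForm (D b h) (Qr b h) (hUb b hb h))
      (gR := fun b => (1 / 2 : ℝ) * (qr b + qc b) * Ub b)
      (fun b => mul_nonneg (mul_nonneg (by norm_num) (add_nonneg (hqr0 b) (hqc0 b))) (hUb0 b))
      (fun b hb h l => quadLip_le (Qr b h) (hUb0 b) (hqr b hb h) (hqc b hb h) l)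
      hexp hms1 hms2 hm1 hm2 hc hPv Ω N₀ emb hemb hργ hκ hcoer hMrow hMcol hNK hβr hBr hβc hBc
      hα₀ hα' hω0 hωb' hWm hWb Mf hκ₁ Jset hA hc0 hcg hε hE hdomA hP hr0 hr1 hgeo
  -- monotonicity of the bound in s_r s_c
  refine main.trans ?_
  have h1α : 0 ≤ 1 / (1 - α₀) := div_nonneg zero_le_one (by linarith)
  have hMμ : 0 ≤ μ.real Set.univ * Real.exp ((κ₁ ^ 2 - 1) * Etot) :=
    mul_nonneg measureReal_nonneg (Real.exp_pos _).le
  have hPr : 0 ≤ P / (1 - r) := div_nonneg hP (by linarith)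
  refine mul_le_mul_of_nonneg_left ?_ h1α
  refine mul_le_mul_of_nonneg_right (mul_le_mul_of_nonneg_right ?_ hMμ) hPr
  exact mul_le_mul_of_nonneg_left (mul_le_mul_of_nonneg_left hss (sq_nonneg C)) (by norm_num)

end EndToEnd

end Literature.MathematicalPhysics.QuantumFieldTheory.Balaban1983to89.T4PrecisionDecay
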